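import Mathlib.AlgebraicGeometry.Morphisms.Basic
import Mathlib.AlgebraicGeometry.Restrict
import HarnessLib

/-!
# Zariski-locality on a union of two opens; isomorphism over an open from a chart

Topic: `Literature/AlgebraicGeometry/Morphisms`. THEOREMS ONLY (no definition, no named fact, no
`sorry`). Generic scheme plumbing split off the (W0) assembly of road W (cell `hodgecm-mathlib`,
D-0151; B-p18 layout ruling 2026-08-28T13:02:18Z (4)); banked leaf, no floor change.

* `Morphisms.of_homOfLE_of_homOfLE` — for a property `P` of morphisms local at the source
  (Mathlib `IsZariskiLocalAtSource`), a morphism `F : D → T` out of an open `D ⊆ X` and opens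
  `V, U ≤ D`: `P (F|V)` and `P (F|U)` imply `P (F|(V ⊔ U))` (restrictions spelled `X.homOfLE _ ≫ F`).
* `Morphisms.isIso_morphismRestrict_of_chart` — for `G : V' → X` out of an open `V' ⊇ U₀` with
  `G ⁻¹ U₀ = V' ∩ U₀` (e.g. `G` a morphism over a base `S` and `U₀` the preimage of an open of
  `S`), if `G|U₀` is an open immersion whose image contains `U₀` then the restriction
  `G ∣_ U₀ : G ⁻¹ U₀ → U₀` is an isomorphism.

## References

* U. Görtz, T. Wedhorn, *Algebraic Geometry I: Schemes*, 2nd ed. (2020), (4.9) «local on the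
  source / on the target», Prop. 4.32 (permanence of open immersions). [GortzWedhorn2020]
-/

noncomputable section

open CategoryTheory CategoryTheory.Limits AlgebraicGeometry

universe u

namespace Literature.AlgebraicGeometry.Morphisms

/-- For opens `V, V' ≤ D` of a scheme `X`, the open `V' ∩ V` of `V'` maps into `V` by an open
immersion compatible with the inclusions into `D`. [folklore] -/
private theorem exists_openImmersion_preimage_homOfLE {X : Scheme.{u}} {D V V' : X.Opens} (hV : V ≤ D)
    (hV' : V' ≤ D) :
    ∃ θ : ((V'.ι ⁻¹ᵁ V : (V' : Scheme.{u}).Opens) : Scheme.{u}) ⟶ (V : Scheme.{u}),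
      IsOpenImmersion θ ∧ θ ≫ X.homOfLE hV = (V'.ι ⁻¹ᵁ V).ι ≫ X.homOfLE hV' := by
  have hrange : Set.range ((V'.ι ⁻¹ᵁ V).ι ≫ X.homOfLE hV').base ⊆ Set.range (X.homOfLE hV).base := by
    rintro _ ⟨w, rfl⟩
    have hw : (V'.ι.base w.1) ∈ V := w.2
    refine ⟨⟨w.1.1, hw⟩, ?_⟩
    apply Subtype.ext
    change ((X.homOfLE hV).base ⟨w.1.1, hw⟩).1 = ((X.homOfLE hV').base ((V'.ι ⁻¹ᵁ V).ι.base w)).1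
    rw [Scheme.homOfLE_apply, Scheme.homOfLE_apply]
    rfl
  refine ⟨IsOpenImmersion.lift (X.homOfLE hV) ((V'.ι ⁻¹ᵁ V).ι ≫ X.homOfLE hV') hrange, ?_,
    IsOpenImmersion.lift_fac _ _ _⟩
  have : IsOpenImmersion (IsOpenImmersion.lift (X.homOfLE hV) ((V'.ι ⁻¹ᵁ V).ι ≫ X.homOfLE hV')
      hrange ≫ X.homOfLE hV) := by
    rw [IsOpenImmersion.lift_fac]
    infer_instance
  exact IsOpenImmersion.of_comp _ (X.homOfLE hV)

/-- **Zariski-locality on `V ⊔ U`.** For a property `P` of morphisms local at the source, a morphism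
`F : D → T` out of an open `D ⊆ X`, and opens `V, U ≤ D`: if `F` has `P` on `V` and on `U` then it
has `P` on `V ⊔ U` (the two-open case of «`P` is local on the source», Görtz–Wedhorn (4.9) (2)).
[cite: GortzWedhorn2020, Section (4.9) and Proposition 4.32] -/
theorem of_homOfLE_of_homOfLE {X T : Scheme.{u}} (P : MorphismProperty Scheme.{u})
    [IsZariskiLocalAtSource P] {D V U : X.Opens} (hV : V ≤ D) (hU : U ≤ D)
    (F : (D : Scheme.{u}) ⟶ T) (h1 : P (X.homOfLE hV ≫ F)) (h2 : P (X.homOfLE hU ≫ F)) :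
    P (X.homOfLE (sup_le hV hU) ≫ F) := by
  have hV'D : V ⊔ U ≤ D := sup_le hV hU
  let W : Bool → ((V ⊔ U : X.Opens) : Scheme.{u}).Opens := fun b =>
    bif b then (V ⊔ U).ι ⁻¹ᵁ V else (V ⊔ U).ι ⁻¹ᵁ U
  have hW : iSup W = ⊤ := by
    rw [iSup_bool_eq]
    change (V ⊔ U).ι ⁻¹ᵁ V ⊔ (V ⊔ U).ι ⁻¹ᵁ U = ⊤
    have : (V ⊔ U).ι ⁻¹ᵁ V ⊔ (V ⊔ U).ι ⁻¹ᵁ U = (V ⊔ U).ι ⁻¹ᵁ (V ⊔ U) :=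
      TopologicalSpace.Opens.ext (by
        simp only [TopologicalSpace.Opens.coe_sup, TopologicalSpace.Opens.map_coe,
          Set.preimage_union])
    rw [this]
    exact Scheme.Opens.ι_preimage_self _
  refine IsZariskiLocalAtSource.of_iSup_eq_top W hW fun b => ?_
  cases b with
  | false =>
    obtain ⟨θ, hθ, hθfac⟩ := exists_openImmersion_preimage_homOfLE (X := X) hU hV'D
    change P (((V ⊔ U).ι ⁻¹ᵁ U).ι ≫ X.homOfLE hV'D ≫ F)
    rw [← Category.assoc, ← hθfac, Category.assoc]
    exact IsZariskiLocalAtSource.comp h2 θ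
  | true =>
    obtain ⟨θ, hθ, hθfac⟩ := exists_openImmersion_preimage_homOfLE (X := X) hV hV'D
    change P (((V ⊔ U).ι ⁻¹ᵁ V).ι ≫ X.homOfLE hV'D ≫ F)
    rw [← Category.assoc, ← hθfac, Category.assoc]
    exact IsZariskiLocalAtSource.comp h1 θ

/-- **Iso over `U₀` from a chart.** Let `G : V' → X` be a morphism out of an open `V' ⊇ U₀` of `X`
with `G ⁻¹ U₀ = V' ∩ U₀` (e.g. `G` a morphism over a base `S` and `U₀` the preimage of an open of
`S`), such that `G|U₀` is an open immersion whose image contains `U₀`. Then the restriction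
`G ∣_ U₀ : G ⁻¹ U₀ → U₀` is an isomorphism (an open immersion — open immersions are stable under
composition and local on the target — which is surjective).
[cite: GortzWedhorn2020, Proposition 4.32] -/
theorem isIso_morphismRestrict_of_chart {X : Scheme.{u}} {V' U₀ : X.Opens} (hU : U₀ ≤ V')
    (G : (V' : Scheme.{u}) ⟶ X) (hG : G ⁻¹ᵁ U₀ = V'.ι ⁻¹ᵁ U₀)
    [IsOpenImmersion (X.homOfLE hU ≫ G)]
    (hsurj : (U₀ : Set X) ⊆ Set.range (X.homOfLE hU ≫ G).base) : IsIso (G ∣_ U₀) := by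
  -- the chart `κ : G⁻¹ U₀ ≅ U₀` inside `V'`
  have hrange : Set.range (G ⁻¹ᵁ U₀).ι.base = Set.range (X.homOfLE hU).base := by
    rw [Scheme.Opens.range_ι, hG]
    ext v
    constructor
    · intro hv
      refine ⟨⟨v.1, hv⟩, ?_⟩
      apply Subtype.ext
      exact Scheme.homOfLE_apply _ _
    · rintro ⟨u, rfl⟩
      change ((X.homOfLE hU).base u).1 ∈ U₀
      rw [Scheme.homOfLE_apply]
      exact u.2
  let κ := IsOpenImmersion.isoOfRangeEq (G ⁻¹ᵁ U₀).ι (X.homOfLE hU) hrange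
  have hκ : κ.hom ≫ X.homOfLE hU = (G ⁻¹ᵁ U₀).ι := IsOpenImmersion.isoOfRangeEq_hom_fac _ _ _
  -- `(G ∣_ U₀) ≫ U₀.ι = κ.hom ≫ (U₀-chart)`, an open immersion
  have hfac : (G ∣_ U₀) ≫ U₀.ι = κ.hom ≫ (X.homOfLE hU ≫ G) := by
    rw [morphismRestrict_ι, ← Category.assoc, hκ]
  haveI : IsOpenImmersion ((G ∣_ U₀) ≫ U₀.ι) := by
    rw [hfac]
    infer_instance
  haveI : IsOpenImmersion (G ∣_ U₀) := IsOpenImmersion.of_comp _ U₀.ι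
  -- surjective
  haveI : Epi (G ∣_ U₀).base := by
    rw [TopCat.epi_iff_surjective]
    intro u
    obtain ⟨x, hx⟩ := hsurj u.2
    refine ⟨κ.inv.base x, ?_⟩
    apply Subtype.ext
    change (((G ∣_ U₀) ≫ U₀.ι).base (κ.inv.base x)) = u.1
    rw [hfac]
    change ((κ.inv ≫ κ.hom) ≫ (X.homOfLE hU ≫ G)).base x = u.1
    rw [Iso.inv_hom_id, Category.id_comp]
    exact hx
  exact IsOpenImmersion.isIso (G ∣_ U₀)

end Literature.AlgebraicGeometry.Morphisms

end
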